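import Mathlib
import HarnessLib
import HarnessLib.Audit
import Summits.QuantumAdvantage.Statement
import Literature.Computability.QuantumComplexity.StabilizerRank

/-!
Route: CodeFlattening

CLOSED (retired) 2026-08-15T13:50:51Z by operator:999:1257524 — reason: not-a-thesis: assembly does not conclude the sub-problem Statement — note: D-0027 §2.1 audit (human 2026-08-15: routes that do not decide the summit are removed): the assembly concludes `∃ δ : ℝ, 0 < δ ∧ δ < 1 ∧ ∀ c : ℕ, ∃ t : ℕ, t ^ c + c < Literature.Computability.QuantumComplexity.approxStabilizerRank δ (Literature.Computability.QuantumComple`, not the sub-problem state. The file is kept as the record of this route; refuted decls are indexed as negative knowledge (`ledger negatives`).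

ENGINE ROUTE for the S-side kill item stmt-QuantumAdvantage-0247 (=
Dequantize.DeqNegStabrankSuperpoly, superpolynomial δ-approximate stabilizer rank of |T⟩^{⊗n});
realises idea card every-certificate-of-magic-is-a-code. It suffices to show X =
`RobustFlatteningWitness`: for some δ ∈ (0,1) and every c there are n, a degree k ≥ 1 and a LINEAR
FLATTENING L of (k·n)-qubit tensors into matrices whose rank is ≤ r on every block product σ₁⊗…⊗σ_k
of n-qubit stabilizer states but exceeds (n^c + c)^k · r on φ^{⊗k} for EVERY φ with ‖T^{⊗n} − φ‖ ≤
δ. Lean (decl RobustFlatteningWitness, over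
Literature.Computability.QuantumComplexity.{stabilizerStates, tensorPow, magicT} and
Literature.Computability.Cryptography.{QReg, normSq}; block j, qubit i ↦ wire finProdFinEquiv
(j,i)): `∃ δ : ℝ, 0 < δ ∧ δ < 1 ∧ ∀ c : ℕ, ∃ (k n a b r : ℕ) (L : (QReg (k * n) → ℂ) →ₗ[ℂ] Matrix
(Fin a) (Fin b) ℂ), 1 ≤ k ∧ (∀ σ : Fin k → QReg n → ℂ, (∀ j, σ j ∈ stabilizerStates n) → (L (fun z
=> ∏ j, σ j (fun i => z (finProdFinEquiv (j, i))))).rank ≤ r) ∧ ∀ φ, normSq (tensorPow magicT n - φ)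
≤ δ ^ 2 → (n ^ c + c) ^ k * r < (L (fun z => ∏ j, φ (fun i => z (finProdFinEquiv (j, i))))).rank`.
By the polarised flattening inequality rank L(ψ^{⊗k}) ≤ χ(ψ)^k · r (support FlatteningBound:
multilinearity + rank subadditivity) X forces χ(φ) > n^c + c for every φ in the δ-ball, i.e.
χ_δ(T^{⊗n}) > n^c + c: the Assembly `StabDecompExists → FlatteningBound → RobustFlatteningWitness →
(∃ δ ∈ (0,1), ∀ c, ∃ t, t^c + c < approxStabilizerRank δ (tensorPow magicT t))` ends in 0247's
statement VERBATIM (re-wanted here as Target), not in QuantumAdvantage or ¬QuantumAdvantage: closing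
0247 refutes the hypothesis of Dequantize #2/#6 (BQP ⊆ BPP resp. ⊆ P/poly by stabilizer-rank
simulation); it does not decide the summit, and the route says so. WHERE TO LOOK for L (the card's
content): Clifford-EQUIVARIANT flattenings make the stabilizer-side rank a single number (Cliffords
act transitively on stabilizer states), and by the Schur–Weyl duality for the Clifford group they
are exactly the linear combinations of self-dual-code operators R(T) = r(T)^{⊗n}, T a stochastic
Lagrangian subspace of F₂^{2t} (GrossNezamiWalter2021 Thm 1.1, Lemma 4.5, Thm 4.3: ∏_{k≤t-2}(2^k+1)
operators, a basis of the commutant for n ≥ t-1, INDEPENDENT of n) — "every algebraic certificate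
that a state is not a short sum of stabilizer states is a self-dual binary code read as an
operator". The exact horn (ExactFlatteningWitness → ExpStabilizerRank, exponential EXACT rank,
itself open beyond Ω(n)) and the barrier horn (DegreeOneCommutantBlind: bounded-degree equivariant
certificates prove only O_t(1)) are the other two cruxes; either resolution of the barrier horn is
new knowledge for every refuter of 0247.

Rationale: WHY THIS LINE. Every explicit (border-)rank lower bound in algebraic complexity is a flattening: a
linear/polynomial map F into matrices with rank F small on the free set and large on the target
(LandsbergOttaviani2015; EfremenkoGargOliveiraWigderson2018 for the limits of "rank methods"). For
STABILIZER rank nobody has evaluated one. The import from coding/representation theory: the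
Clifford-equivariant flattenings of degree t are spanned by the code operators R(T)=r(T)^{⊗n}, T ∈
Σ_{t,t}(2) self-dual binary codes (GrossNezamiWalter2021 Thm 1.1/4.3, Lemma 4.20; Nebe–Rains–Sloane
arXiv:math/0001038 for the invariants), a FINITE list per degree, independent of n; equivariance
makes r_stab a single number, and the polarised inequality rank L(ψ^{⊗k}) ≤ χ(ψ)^k·r_mix
(FlatteningBound) turns each list entry into a lower bound. Robust by construction (ranks/singular
values, no stabilizer Gram inversion — cf. card stabilizer-frame-conditioning). Status of 0247's
object: exact χ(T^{⊗n}) = Ω(n) (PelegShpilkaVolk2022 Thm 1.1; arXiv:2110.07781), approximate Ω̃(n²)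
(MehrabanTahmasbi2024 Thm 1.1), unchanged in arXiv:2605.28586 p.4; exponential exact rank is known
only for transcendental product states (arXiv:2110.07781 §1, Moulton), not for |T⟩.
WHAT THIS SESSION ALREADY SETTLED (planner's probe, folder kit/codeflat.py, pure linear algebra over
the 2^t×2^{t-1} single-letter matrices; reproducible in seconds): (i) a SINGLE code operator is
exactly rank-blind at degree 1 for every T (proof sketch via GNW Lemma 4.20: r(T) ∝ partial isometry
CSS(T_RD)→CSS(T_LD), so rank r(T)(v⊗1) = rank of the CSS projector on v⊗(ℂ²)^{⊗(t-1)}, a coset count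
independent of v ≠ 0; filed as support SingleCodeDegreeOneBlind; verified numerically for all 30
codes of Σ_{4,4}, all 270 of Σ_{5,5}, 1287 sampled of Σ_{6,6}, 300 of Σ_{7,7}); (ii) for degrees k =
2,3,4 and the same codes the single-letter rank at |T⟩^{⊗k} NEVER exceeds the maximum over MIXED
single-qubit stabilizer k-tuples (it does exceed max_σ rank at σ^{⊗k} for 6/30 codes at t=4 — the
σ^{⊗k}-in-the-code-space effect — but polarisation, e.g. the tuple (|0⟩,|+⟩), washes it out). So
single codes are dead at the single-letter level for t ≤ 7: a witness must be a genuine LINEAR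
COMBINATION in the commutant (n-independent coefficient space of dimension |Σ_{t,t}| ~ 2^{t²/2}, so
heuristically ratio ≤ O_t(1) at fixed t — crux DegreeOneCommutantBlind) or must let the degree t
grow with n (t ~ √n gives 2^{Θ(n)} coefficients) or drop equivariance. The cruxes are typed for
arbitrary linear L so that all three options count.
RANKED CRUXES. (2) DegreeOneCommutantBlind [barrier horn, constant-factor form]: ∀ t ∃ C ∀ n ∀ A ∈
span{R(T)}: rank A(ψ⊗1^{⊗t}) ≤ C·rank A(|0ⁿ⟩⊗1^{⊗t}) for every ψ — most informative and finitely
testable (t+1 = 4: 30 coefficients, n ≤ 3 by exact linear algebra); proved ⇒ degree-1 equivariant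
certificates give O_t(1) only (an EGOW-type barrier for magic, new); refuted ⇒ first code
combination that sees magic rank, feeding (3). (3) ExactFlatteningWitness [positive horn]:
eventually in n some linear flattening (degree k, any arity, may grow with n) has stabilizer-block
rank ≤ r and rank > r·2^{ckn} at T^{⊗kn} ⇒ (ExactGlue) χ(T^{⊗n}) > 2^{cn} (ExpStabilizerRank;
already far beyond print). (4) RobustFlatteningWitness [load-bearing for the Assembly]: the δ-ball
version ⇒ 0247.
SUPPORT (provable now, calibrate the formalism): StabDecompExists (basis states are stabilizer
states: X = H S S H), FlatteningBound (Finset.prod_univ_sum + Matrix.rank_add_le; card (Fin k → Fin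
s) = s^k), ExactGlue and Assembly (sInf bookkeeping over nonempty sets), SingleCodeDegreeOneBlind
(first GNW content in the tree; inline encoding: T : Finset (QReg (t+1) × QReg (t+1)), card 2^{t+1},
xor-closed, |x| ≡ |y| mod 4, (1,1) ∈ T; R(T) and the slot-0 embedding as Matrix.of over QReg
((t+1)*n)).
KILL CRITERIA. DegreeOneCommutantBlind proved for all t AND the analogous polarised statement (all
degrees k ≤ t, combinations) proved ⇒ bounded-degree equivariant certificates are capped at O_t(1):
the positive horn then needs t = t(n) → ∞ or non-equivariant L; if in addition a counting/dimension
argument caps growing-degree certificates (EfremenkoGargOliveiraWigderson2018-style), close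
`exhausted` with the barrier theorems as the census (they stay as negative knowledge for 0247). A
refutation of FlatteningBound or StabDecompExists would mean the formal encoding is wrong (repair,
not close). 0247 refuted (poly χ_δ) ⇒ route moot.
DELIBERATELY NOT DECOMPOSED (tenure, glued splits ≤ 3 children): ExactFlatteningWitness →
{SingleLetterGap (finite: some code/combination, degree k, block size n₀ with ratio > 1),
Multiplicativity (entangled stabilizer tuples across n₀-blocks gain ≤ 2^{o(n)} over product tuples —
why it might fail: a Bell pair across a cut can gain the Schmidt factor), glue by tensoring};
RobustFlatteningWitness → {exact witness with singular-value margin, Lipschitz bound for φ ↦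
L(φ^{⊗k}), Eckart–Young}; the all-degree barrier; GNW Thm 1.1 itself (spanning) is NOT needed by any
item — only the easy direction (R(T) commutes, Lemma 4.5) enters SingleCodeDegreeOneBlind's informal
proof, and the cruxes quantify over arbitrary linear L. No named unproved fact is imported: every
decl rests on definitions (StabilizerRank.lean, QubitRegister.lean) — provers can start at once.
CATALOGUE USED: duality/representation theory (Schur–Weyl for the Clifford group) +
certificate-by-flattening (algebraic complexity) + coding theory (self-dual codes) + a certified
finite computation; no physical analogy, no oracle, no probabilistic model.
NOVELTY: new-combination (audit grade of the card; searches listed in the Novelty field):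
Young-flattening template × Clifford Schur–Weyl duality, plus the single-letter reductions and the
barrier horn, none in PSV22/LS22/MT24/KS25/LR26 or GNW/MMG (arXiv:2208.01688). BARRIERS:
technique_class lower-bound meets SeparationPrerequisites only nominally (in-model statement about
an explicit state; implies nothing about BPP vs PP); NaturalProofs not engaged (property of states,
bound on stabilizer rank not circuit size); details in the Barriers field.

Novelty: Nearest prior art (searched 2026-08-15; searchd/FTS down, arXiv/OpenAlex/S2 APIs rate-limited (HTTP
429), so the negative is: held-paper greps + galaxy + the card's audit): GrossNezamiWalter2021
(arXiv:1712.08628, read pp.4,18-25: Thm 1.1/4.3 commutant of Clifford tensor powers = span of R(T),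
T stochastic Lagrangian; Lemma 4.20 r(T) ∝ partial isometry between CSS codes; Thm 4.21; used there
for stabilizer TESTING, designs, de Finetti — never for rank lower bounds); Montealegre-Mora–Gross
arXiv:2208.01688 (mixed tensor powers); Nebe–Rains–Sloane arXiv:math/0001038 (invariants = weight
enumerators); flattening template LandsbergOttaviani2015 / LandsbergOttaviani2011, rank-method
limits EfremenkoGargOliveiraWigderson2018 (arXiv:1710.09502). Stabilizer-rank lower bounds in print
use other engines: PelegShpilkaVolk2022 (arXiv:2106.03214, subcube restrictions + approximate
degree, Ω(n) exact), arXiv:2110.07781 Lovitz–Steffan (Moulton subset-sum, exponential rank only for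
transcendental product states; generic rank by secants), MehrabanTahmasbi2024 (arXiv:2305.10277,
probabilistic, Ω̃(n²) approximate), arXiv:2503.04101 Kalra–Sinha (Barnes–Wall/Minkowski),
arXiv:2605.28586 Labib–Russo 2026 (status p.4 unchanged: Ω(m) exact, Ω̃(m²) approximate) — `lit read
--grep 'flattening|commutant|Schur|weight enumerator|self-dual|Nezami'` over all five: 0 hits; `lit
galaxy search "stabilizer rank" --star all`: 11 pdf hits (BBCCGH19, Labib thesis, Lovitz project
description, ZX/T-decomposition, P  [refs: 1712.08628, 2208.01688, math/0001038, 1710.09502, 2106.03214, 2110.07781, 2305.10277, 2503.04101, 2605.28586, GrossNezamiWalter2021, LandsbergOttaviani2015, LandsbergOttaviani2011, EfremenkoGargOliveiraWigderson2018, PelegShpilkaVolk2022, MehrabanTahmasbi2024]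

Barriers (technique_class: lower-bound, flattenings, invariant-theory, coding-theory): technique_class: lower-bound, flattenings, invariant-theory, coding-theory
Literature.Barriers.QuantumAdvantage.SeparationPrerequisites: met only through the token
"lower-bound". The barrier (SeparationPrerequisites.of_facts, proved) says an unconditional proof of
the SUMMIT is simultaneously a proof of PP ⊄ BPP, P ≠ PP, P ≠ P^{#P}, P ≠ PSPACE. This route does
not prove the summit or any class separation: its terminal statement is stmt-0247, an in-model lower
bound on the approximate stabilizer rank of the explicit state |T⟩^{⊗n}, which implies nothing about
BPP vs PP (it only removes ONE classical simulation method, the stabilizer-rank simulation behind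
Dequantize #2/#6). Not engaged; recorded honestly as "engine route below the barrier's scope".
Literature.Barriers.QuantumAdvantage.NaturalProofs: not in the technique_class intersection but the
nearest in spirit. A flattening rank test is a constructive (poly(2ⁿ)-time), large property — of
STATES, bounding stabilizer rank, not of Boolean functions bounding circuit size;
NaturalProofs.no_naturalProof_bqp_not_ppoly / the PneNP natural-proofs barrier it re-exports concern
P/poly-useful properties under HardPRGExist and say nothing here (low-stabilizer-rank states are not
claimed pseudorandom against 2^{O(n)}-time rank tests). Not engaged. The relevant NON-catalogued
caution is the rank-method barrier of EfremenkoGargOliveiraWigderson2018 (arXiv:1710.09502):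
flattenings of bounded degree are capped for TENSOR rank at small multi

History (route lifecycle, newest last):
- 2026-08-15T13:50:51Z · CLOSED retired — not-a-thesis: assembly does not conclude the sub-problem Statement (operator:999:1257524)

sub-problem: QuantumAdvantage · status: closed(retired) · opened planner-plancard-QuantumAdvantage-QuantumAdva-b6f3987a-0 2026-08-15T11:00:52Z · rev 0 · ledger route-QuantumAdvantage-CodeFlattening
GENERATED by the gate from the ledger (D-0016/17). Provers cite these decls: `theorem foo : Summit.QuantumAdvantage.QuantumAdvantage.Theses.CodeFlattening.<Decl> := …` in Summits/QuantumAdvantage/QuantumAdvantage/Theorems/<Name>.lean.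
-/

namespace Summit.QuantumAdvantage.QuantumAdvantage.Theses.CodeFlattening

open scoped BigOperators Topology Manifold Classical MeasureTheory ProbabilityTheory Matrix InnerProductSpace ComplexConjugate ContinuousMap
open Filter Set Function TopologicalSpace MeasureTheory

attribute [summit_statement] _root_.QuantumAdvantage

open Literature.QuantumAdvantage

/-- item stmt-QuantumAdvantage-0247 · target · rank 0 · open · by planner
why it might fail: May be FALSE (poly χ_δ(T^{⊗t}) for every δ<1 is not excluded; upper bound 2^{0.396t}) and is beyond every technique in print: Ω(t) exact / Ω̃(t²) approximate (PSV22 Thm 1.1-1.2, MT24 Thm 1.1, arXiv:2605.28586 p.4); superpolynomial only conditionally (MT24 Thm 1.6).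
sources: MehrabanTahmasbi2024 = arXiv:2305.10277 Thm 1.1, PelegShpilkaVolk2022 = arXiv:2106.03214 Thm 1.1-1.2, arXiv:2605.28586 p.4 (status 2026: Ω(m) exact, Ω̃(m²) approximate), BravyiEtAl2019 = arXiv:1808.00128 p.6 (upper bound O(δ⁻² 2^{0.396 t}); no superpolynomial technique), ledger stmt-QuantumAdvantage-0247 (route Dequantize, decl DeqNegStabrankSuperpoly)
NEGATION of the hypothesis half of #2 (filed so the S-side is staffed): ∃ δ ∈ (0,1) such that for
every polynomial q there is t with χ_δ(|T⟩^{⊗t}) > q(t). OPEN; the best lower bounds in print are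
Ω-polynomial of degree ≤ 2 (PelegShpilkaVolk2022 via higher-order Fourier analysis / quadratic phase
structure of stabilizer states, Labib2022, MehrabanTahmasbi2024 probabilistic method). Proving it
kills crux #2 of Dequantize (does NOT prove QuantumAdvantage). Imported field: additive
combinatorics (Gowers U³ inverse theory over 𝔽₂ⁿ). NEEDS DEFINITION: approxStabilizerRank.
[needs_definition: approxStabilizerRank] -/
@[route_item "route-QuantumAdvantage-CodeFlattening"]
def NegApproxStabRankPoly : Prop :=
  ∃ δ : ℝ, 0 < δ ∧ δ < 1 ∧ ∀ c : ℕ, ∃ t : ℕ, t ^ c + c < Literature.Computability.QuantumComplexity.approxStabilizerRank δ (Literature.Computability.QuantumComplexity.tensorPow Literature.Computability.QuantumComplexity.magicT t)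

/-- item stmt-QuantumAdvantage-2110 · crux · rank 2 · closed · moot by None · by planner
why it might fail: Cancellation among tensor powers can beat any constant (parity example: 2^-k Σ_s D_s^{⊗n} has rank 2^{n-k}); a tuned a ∈ ℂ^{|Σ|} might align images at stabilizer inputs but not at |T⟩^{⊗n}, with ratio growing in n — nothing in print bounds it.
sources: GrossNezamiWalter2021 Thm 1.1, Lemma 4.5, Lemma 4.20, Thm 4.7 (arXiv:1712.08628 pp.4, 19-24), EfremenkoGargOliveiraWigderson2018 = arXiv:1710.09502 (rank-method barrier template), planner probe kit/codeflat.py (route folder): |Σ_{4,4}| = 30, |Σ_{5,5}| = 270 enumerated, degree-1 single-letter rank constant for every code; 1287 + 300 sampled codes at t+1 = 6, 7 likewise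
[crux] BARRIER HORN (the card's RG, constant-factor form; rank 2 = most informative, finitely
testable). Setting: t+1 tensor copies of n qubits in QReg ((t+1)*n), wire of (copy j, qubit i) =
finProdFinEquiv (j, i); code operator R(T) = r(T)^{⊗n} with r(T) = Σ_{(x,y)∈T} |x⟩⟨y| for T ⊆
F₂^{t+1} × F₂^{t+1} a stochastic Lagrangian subspace (inline: Finset of pairs of Boolean strings,
card 2^{t+1}, (1,1) ∈ T, xor-closed, |x| ≡ |y| mod 4 — GNW Def 4.1; for n ≥ t these R(T) are a basis
of the commutant of the (t+1)-st Clifford tensor power, GNW Thm 1.1, and they commute with it for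
every n, Lemma 4.5); A = Σ_T a_T R(T) an arbitrary combination (a supported on such T); E_ψ = slot-0
embedding matrix (column y' with copy-0 block = 0ⁿ ↦ ψ ⊗ |copies 1..t of y'⟩, other columns 0), so
rank(A·E_ψ) = rank of the degree-1 flattening A(ψ ⊗ 1^{⊗t}). CLAIM: ∀ t ∃ C ∀ n a ψ: rank(A·E_ψ) ≤ C
· rank(A·E_{|0ⁿ⟩}). MEANING: by equivariance rank(A·E_σ) = rank(A·E_{|0ⁿ⟩}) for every stabilizer σ,
and FlatteningBound at k = 1 reads χ(ψ) ≥ rank(A·E_ψ)/rank(A·E_{|0ⁿ⟩}); the claim caps every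
degree-1 Clifford-equivariant certificate at the constant C(t): an
Efremenko–Garg–Oliveira–Wigderson-type barrier for magic. -/
@[route_item "route-QuantumAdvantage-CodeFlattening"]
def DegreeOneCommutantBlind : Prop :=
  ∀ t : ℕ, ∃ C : ℕ, ∀ (n : ℕ) (a : Finset (Literature.Computability.Cryptography.QReg (t + 1) × Literature.Computability.Cryptography.QReg (t + 1)) → ℂ), (∀ T, a T ≠ 0 → T.card = 2 ^ (t + 1) ∧ ((fun _ => true), (fun _ => true)) ∈ T ∧ (∀ p ∈ T, ∀ q ∈ T, ((fun j => Bool.xor (p.1 j) (q.1 j)), (fun j => Bool.xor (p.2 j) (q.2 j))) ∈ T) ∧ (∀ p ∈ T, (Finset.univ.filter fun j => p.1 j = true).card % 4 = (Finset.univ.filter fun j => p.2 j = true).card % 4)) → ∀ ψ : Literature.Computability.Cryptography.QReg n → ℂ, ((∑ T, a T • Matrix.of (fun x y : Literature.Computability.Cryptography.QReg ((t + 1) * n) => ∏ i : Fin n, if ((fun j => x (finProdFinEquiv (j, i))), (fun j => y (finProdFinEquiv (j, i)))) ∈ T then (1 : ℂ) else 0)) * Matrix.of (fun y y' : Literature.Computability.Cryptography.QReg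 ((t + 1) * n) => if (∀ i, y' (finProdFinEquiv (0, i)) = false) ∧ (∀ j, j ≠ 0 → ∀ i, y (finProdFinEquiv (j, i)) = y' (finProdFinEquiv (j, i))) then ψ (fun i => y (finProdFinEquiv (0, i))) else 0)).rank ≤ C * ((∑ T, a T • Matrix.of (fun x y : Literature.Computability.Cryptography.QReg ((t + 1) * n) => ∏ i : Fin n, if ((fun j => x (finProdFinEquiv (j, i))), (fun j => y (finProdFinEquiv (j, i)))) ∈ T then (1 : ℂ) else 0)) * Matrix.of (fun y y' : Literature.Computability.Cryptography.QReg ((t + 1) * n) => if (∀ i, y' (finProdFinEquiv (0, i)) = false) ∧ (∀ j, j ≠ 0 → ∀ i, y (finProdFinEquiv (j, i)) = y' (finProdFinEquiv (j, i))) then Literature.Computability.Cryptography.zeroState n (fun i => y (finProdFinEquiv (0, i))) else 0)).rank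

/-- item stmt-QuantumAdvantage-2111 · crux · rank 3 · closed · moot by None · by planner
why it might fail: Bounded-degree equivariant certificates may be capped at O_t(1) (single codes already blind, t ≤ 7); growing degree may hit an EGOW-type counting cap; non-equivariant gadgets B^{⊗m} lose to stabilizer tuples entangled across blocks (a Bell pair across a cut gains the Schmidt factor).
sources: LandsbergOttaviani2015 (Young flattenings: the template), EfremenkoGargOliveiraWigderson2018 = arXiv:1710.09502 (limits of rank methods), GrossNezamiWalter2021 Thm 1.1 / Lemma 4.20 (arXiv:1712.08628), PelegShpilkaVolk2022 = arXiv:2106.03214 Thm 1.1 (Ω(n) exact), p.6 §1.5 (methods stall at linear), arXiv:2110.07781 §1 (exponential rank only for transcendental product states), §4 (multiplicativity examples), planner probe kit/codeflat.py: degrees 2-4, no single-letter gap for any of 300 codes t+1 ≤ 5 and 1587 sampled codes t+1 = 6,7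
[crux] POSITIVE HORN, exact (rank 3 = the step that makes or breaks the engine). Eventually in n
there are a degree k ≥ 1 and a linear flattening L of (k·n)-qubit tensors (blocks of n wires, wire
(j,i) ↦ finProdFinEquiv (j,i)) into a × b matrices with rank ≤ r on EVERY block product σ₁⊗…⊗σ_k of
n-qubit stabilizer states and rank > r·2^{ckn} at the block product of k copies of T^{⊗n} (=
T^{⊗kn}); with FlatteningBound, χ(T^{⊗n})^k · r ≥ rank > r·2^{ckn}, so χ(T^{⊗n}) > 2^{cn} (support
ExactGlue → ExpStabilizerRank; print has Ω(n): PelegShpilkaVolk2022 Thm 1.1). r = 0 / L = 0 cannot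
cheat (rank > 0 is required on the right). k, a, b, r, L may depend on n (growing degree allowed on
purpose). WHERE TO SEARCH (the card): Clifford-equivariant L = Σ_T a_T R(T) with k slots contracted
and t−k free, because equivariance turns the stabilizer-side supremum into a maximum over
Clifford-orbit representatives and the list {R(T)} is complete and finite per degree
(GrossNezamiWalter2021 Thm 1.1). WHAT IS ALREADY EXCLUDED (this session, kit/codeflat.py +
SingleCodeDegreeOneBlind): a SINGLE code operator never works — degree 1 exactly blind for every T;
degrees 2, 3, 4: single-letter rank at |T⟩^{⊗k} -/
@[route_item "route-QuantumAdvantage-CodeFlattening"]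
def ExactFlatteningWitness : Prop :=
  ∃ c : ℝ, 0 < c ∧ ∃ n₀ : ℕ, ∀ n ≥ n₀, ∃ (k a b r : ℕ) (L : (Literature.Computability.Cryptography.QReg (k * n) → ℂ) →ₗ[ℂ] Matrix (Fin a) (Fin b) ℂ), 1 ≤ k ∧ (∀ σ : Fin k → Literature.Computability.Cryptography.QReg n → ℂ, (∀ j, σ j ∈ Literature.Computability.QuantumComplexity.stabilizerStates n) → (L (fun z => ∏ j, σ j (fun i => z (finProdFinEquiv (j, i))))).rank ≤ r) ∧ (r : ℝ) * (2 : ℝ) ^ (c * k * n) < ((L (fun z => ∏ j : Fin k, Literature.Computability.QuantumComplexity.tensorPow Literature.Computability.QuantumComplexity.magicT n (fun i => z (finProdFinEquiv (j, i))))).rank : ℝ)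

/-- item stmt-QuantumAdvantage-2112 · crux · rank 4 · closed · moot by None · by planner
why it might fail: Even given an exact witness, the determinantal sets {φ : rank L(φ^{⊗k}) ≤ m} are cones of huge dimension and may pass within any fixed δ of the unit vector T^{⊗n}: rank is only lower-semicontinuous and margins of tensor-power certificates typically decay like ρ^{-n}.
sources: MehrabanTahmasbi2024 = arXiv:2305.10277 Thm 1.1 (Ω̃(n²) approximate: the bar), BravyiEtAl2019 = arXiv:1808.00128 §2 (χ_δ; tree def Literature.Computability.QuantumComplexity.approxStabilizerRank, StabilizerRank.lean), arXiv:2503.04101 Cor 3 (fidelity-based bounds and their conditioning limit), hub card stabilizer-frame-conditioning (Gram ill-conditioning as the obstacle flattenings avoid)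
[crux] THESIS X, load-bearing for the Assembly (rank 4: only meaningful once ExactFlatteningWitness
has a witness with margin). δ-robust flattening witness: ∃ δ ∈ (0,1) ∀ c ∃ k ≥ 1, n, a, b, r, L
(linear on (k·n)-qubit tensors, blocks via finProdFinEquiv): stabilizer-block rank ≤ r and rank
L(φ^{⊗k}) > (n^c + c)^k · r for EVERY φ with normSq(T^{⊗n} − φ) ≤ δ² (unnormalised φ, matching the
tree's approxStabilizerRank; BravyiEtAl2019 §2 up to δ ↦ 2δ). Engineering form (for provers): it
suffices that the flattening of T^{⊗kn} has more than (n^c+c)^k·r singular values above Λ·δ', Λ a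
Lipschitz modulus of φ ↦ L(φ^{⊗k}) on the δ-ball (Eckart–Young–Mirsky: a matrix within operator-norm
distance < s_{m+1} has rank > m) — i.e. T^{⊗n} is δ-far from the real-algebraic set {φ : rank
L(φ^{⊗k}) ≤ (n^c+c)^k·r}. Ranks/singular values never invert a stabilizer Gram matrix, so the
conditioning obstruction of fidelity-based bounds (arXiv:2503.04101; hub card
stabilizer-frame-conditioning) does not arise; the price is the margin. With StabDecompExists +
FlatteningBound this gives χ_δ(T^{⊗n}) > n^c + c for every c, i.e. stmt-0247 (Assembly). Why it
might fail: see field. -/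
@[route_item "route-QuantumAdvantage-CodeFlattening"]
def RobustFlatteningWitness : Prop :=
  ∃ δ : ℝ, 0 < δ ∧ δ < 1 ∧ ∀ c : ℕ, ∃ (k n a b r : ℕ) (L : (Literature.Computability.Cryptography.QReg (k * n) → ℂ) →ₗ[ℂ] Matrix (Fin a) (Fin b) ℂ), 1 ≤ k ∧ (∀ σ : Fin k → Literature.Computability.Cryptography.QReg n → ℂ, (∀ j, σ j ∈ Literature.Computability.QuantumComplexity.stabilizerStates n) → (L (fun z => ∏ j, σ j (fun i => z (finProdFinEquiv (j, i))))).rank ≤ r) ∧ ∀ φ : Literature.Computability.Cryptography.QReg n → ℂ, Literature.Computability.Cryptography.normSq (Literature.Computability.QuantumComplexity.tensorPow Literature.Computability.QuantumComplexity.magicT n - φ) ≤ δ ^ 2 → (n ^ c + c) ^ k * r < (L (fun z => ∏ j : Fin k, φ (fun i => z (finProdFinEquiv (j, i))))).rank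

/-- item stmt-QuantumAdvantage-2113 · support · rank 9 · closed · moot by None · by planner
sources: LandsbergOttaviani2015, Mathlib Finset.prod_univ_sum, Matrix.rank
[support] The polarised flattening inequality, provable now and valid for ANY linear L (equivariance
is only the search heuristic): if rank L(σ₁⊗…⊗σ_k) ≤ r for all k-tuples of n-qubit stabilizer states
then for ψ = Σ_{i<s} c_i φ_i (φ_i stabilizer) rank L(ψ^{⊗k}) ≤ s^k · r. Proof: ∏_j (Σ_i c_i
φ_i)(z|_j) = Σ_{f : Fin k → Fin s} (∏_j c_{f j}) · ∏_j φ_{f j}(z|_j) (Finset.prod_univ_sum),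
linearity of L, Matrix.rank of a sum ≤ sum of ranks (Matrix.rank_add_le-type lemma; rank (c • M) ≤
rank M), Fintype.card (Fin k → Fin s) = s^k. (LandsbergOttaviani2015-style flattenings, polarised;
card formula (★).) -/
@[route_item "route-QuantumAdvantage-CodeFlattening"]
def FlatteningBound : Prop :=
  ∀ (n k a b r s : ℕ) (L : (Literature.Computability.Cryptography.QReg (k * n) → ℂ) →ₗ[ℂ] Matrix (Fin a) (Fin b) ℂ), (∀ σ : Fin k → Literature.Computability.Cryptography.QReg n → ℂ, (∀ j, σ j ∈ Literature.Computability.QuantumComplexity.stabilizerStates n) → (L (fun z => ∏ j, σ j (fun i => z (finProdFinEquiv (j, i))))).rank ≤ r) → ∀ (c : Fin s → ℂ) (φ : Fin s → Literature.Computability.Cryptography.QReg n → ℂ), (∀ i, φ i ∈ Literature.Computability.QuantumComplexity.stabilizerStates n) → (L (fun z => ∏ j : Fin k, (∑ i, c i • φ i) (fun i => z (finProdFinEquiv (j, i))))).rank ≤ s ^ k * r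

/-- item stmt-QuantumAdvantage-2114 · support · rank 9 · closed · moot by None · by planner
sources: AaronsonGottesman2004 §I, tree Literature/Computability/QuantumComplexity/StabilizerRank.lean (design note)
[support] Every ψ : QReg n → ℂ is a ℂ-combination of at most 2ⁿ stabilizer states, provable now:
computational basis states |x⟩ = (∏_{i : x i} X_i) |0ⁿ⟩ with X = H·S·S·H (H, S placements generate
it inside cliffordCircuits n = Submonoid.closure (placements clifford n);
mulVec_mem_stabilizerStates, zeroState_mem_stabilizerStates), and ψ = Σ_x ψ(x) • basisState x
(Pi.single expansion; index Fin (2^n) via an equivalence with QReg n). Needed so that the sInf's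
defining stabilizerRank / approxStabilizerRank range over NONEMPTY sets (StabilizerRank.lean design
note: 'a fact not proved here'); used by ExactGlue and Assembly. [AaronsonGottesman2004 §I;
folklore] -/
@[route_item "route-QuantumAdvantage-CodeFlattening"]
def StabDecompExists : Prop :=
  ∀ (n : ℕ) (ψ : Literature.Computability.Cryptography.QReg n → ℂ), ∃ (s : ℕ) (c : Fin s → ℂ) (φ : Fin s → Literature.Computability.Cryptography.QReg n → ℂ), s ≤ 2 ^ n ∧ (∀ i, φ i ∈ Literature.Computability.QuantumComplexity.stabilizerStates n) ∧ ψ = ∑ i, c i • φ i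

/-- item stmt-QuantumAdvantage-2115 · support · rank 9 · closed · moot by None · by planner
sources: PelegShpilkaVolk2022 Thm 1.1, p.6 §1.5, arXiv:2110.07781 §1, arXiv:2605.28586 p.4
[support] Terminal statement of the EXACT horn: ∃ c > 0 ∃ n₀ ∀ n ≥ n₀, 2^{cn} < χ(|T⟩^{⊗n}) —
exponential exact stabilizer rank of magic-state powers. Far beyond print (Ω(n):
PelegShpilkaVolk2022 Thm 1.1, Labib2022 Thm 1.1, arXiv:2110.07781; 'seem incapable of proving
super-linear lower bounds', PSV22 p.6 §1.5; exponential exact rank is known only for product states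
with transcendental amplitudes, arXiv:2110.07781 §1/§3 via Moulton; upper bound χ(T^{⊗n}) ≤ 2^{0.396
n}, arXiv:2605.28586 p.4). NOT to be attacked directly in this route — it is reached via ExactGlue
from ExactFlatteningWitness; filed as a plain decl so that other engines aimed at the same statement
(hub cards counterfeit-magic-dichotomy, magic-asymptotic-spectrum,
specialize-the-angle-reduce-the-prime) share it by signature. -/
@[route_item "route-QuantumAdvantage-CodeFlattening"]
def ExpStabilizerRank : Prop :=
  ∃ c : ℝ, 0 < c ∧ ∃ n₀ : ℕ, ∀ n ≥ n₀, (2 : ℝ) ^ (c * n) < (Literature.Computability.QuantumComplexity.stabilizerRank (Literature.Computability.QuantumComplexity.tensorPow Literature.Computability.QuantumComplexity.magicT n) : ℝ)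

/-- item stmt-QuantumAdvantage-2116 · support · rank 9 · closed · moot by None · by planner
sources: Mathlib Nat.sInf_mem
[support] StabDecompExists → FlatteningBound → ExactFlatteningWitness → ExpStabilizerRank, provable
now: take c, n₀ from the witness; for n ≥ n₀ get k, a, b, r, L; the set defining χ := stabilizerRank
(tensorPow magicT n) is nonempty (StabDecompExists) so χ is attained by a decomposition T^{⊗n} =
Σ_{i<χ} c_i φ_i (Nat.sInf_mem); rewrite the block product of k copies of T^{⊗n} as the block product
of the sum and apply FlatteningBound: rank ≤ χ^k · r; with r·2^{ckn} < rank this gives r > 0 and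
2^{ckn} < χ^k, hence 2^{cn} < χ (Real.rpow_natCast / rpow_le_rpow_left_iff-type monotonicity, k ≥
1). Same c, same n₀. -/
@[route_item "route-QuantumAdvantage-CodeFlattening"]
def ExactGlue : Prop :=
  StabDecompExists → FlatteningBound → ExactFlatteningWitness → ExpStabilizerRank

/-- item stmt-QuantumAdvantage-2117 · support · rank 9 · closed · moot by None · by planner
sources: GrossNezamiWalter2021 Lemma 4.20, Prop 4.14 (arXiv:1712.08628 pp.23-24), planner probe kit/codeflat.py
[support] CALIBRATION THEOREM, provable now (first Gross–Nezami–Walter content in the tree;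
generalises the card's P2 'Π₄ is blind' to EVERY single code). For every stochastic Lagrangian T ⊆
F₂^{t+1} × F₂^{t+1} (inline encoding: T : Finset (QReg (t+1) × QReg (t+1)) with T.card = 2^{t+1},
(1,1) ∈ T, closed under coordinatewise xor, |x| ≡ |y| (mod 4) for (x,y) ∈ T — GNW Def 4.1; for d = 2
Lagrangian ⇒ stochastic, GNW p.18) and every n: the degree-1 flattening of R(T) = r(T)^{⊗n} (matrix
entry (x,y) ↦ ∏_{i<n} [(x_{·,i}, y_{·,i}) ∈ T] on QReg ((t+1)*n), wire (j,i) ↦ finProdFinEquiv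
(j,i)) has the SAME rank at |T⟩^{⊗n} as at |0ⁿ⟩: rank(R(T)·E_{T^{⊗n}}) = rank(R(T)·E_{|0ⁿ⟩}) with
E_ψ the slot-0 embedding (column y' with copy-0 block all-false ↦ Σ_u ψ(u) |u, copies 1..t of y'⟩;
other columns 0). PROOF SKETCH: both sides tensorise over the n qubits: rank = ρ(v)^n with ρ(v) =
rank of r(T)(v ⊗ 1^{⊗t}) on (ℂ²)^{⊗t}, v = |T⟩ resp. |0⟩ (image of a tensor product of maps = tensor
product of images). By GNW Lemma 4.20, r(T) = |T_LD| Σ_{[y] ∈ N^⊥/N} |T_LD, J[y]⟩⟨N,[y]| with N =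
T_RD = {y : (0,y) ∈ T} the right defect space (N ⊆ N^⊥, e₁ ∉ N since |e₁| = 1 ≢ 0 mod 4) and the
|T_LD, J[y]⟩ orthonormal -/
@[route_item "route-QuantumAdvantage-CodeFlattening"]
def SingleCodeDegreeOneBlind : Prop :=
  ∀ (t n : ℕ) (T : Finset (Literature.Computability.Cryptography.QReg (t + 1) × Literature.Computability.Cryptography.QReg (t + 1))), T.card = 2 ^ (t + 1) → ((fun _ => true), (fun _ => true)) ∈ T → (∀ p ∈ T, ∀ q ∈ T, ((fun j => Bool.xor (p.1 j) (q.1 j)), (fun j => Bool.xor (p.2 j) (q.2 j))) ∈ T) → (∀ p ∈ T, (Finset.univ.filter fun j => p.1 j = true).card % 4 = (Finset.univ.filter fun j => p.2 j = true).card % 4) → (Matrix.of (fun x y : Literature.Computability.Cryptography.QReg ((t + 1) * n) => ∏ i : Fin n, if ((fun j => x (finProdFinEquiv (j, i))), (fun j => y (finProdFinEquiv (j, i)))) ∈ T then (1 : ℂ) else 0) * Matrix.of (fun y y' : Literature.Computability.Cryptography.QReg ((t + 1) * n) => if (∀ i, y' (finProdFinEquiv (0, i)) = false) ∧ (∀ j,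 j ≠ 0 → ∀ i, y (finProdFinEquiv (j, i)) = y' (finProdFinEquiv (j, i))) then Literature.Computability.QuantumComplexity.tensorPow Literature.Computability.QuantumComplexity.magicT n (fun i => y (finProdFinEquiv (0, i))) else 0)).rank = (Matrix.of (fun x y : Literature.Computability.Cryptography.QReg ((t + 1) * n) => ∏ i : Fin n, if ((fun j => x (finProdFinEquiv (j, i))), (fun j => y (finProdFinEquiv (j, i)))) ∈ T then (1 : ℂ) else 0) * Matrix.of (fun y y' : Literature.Computability.Cryptography.QReg ((t + 1) * n) => if (∀ i, y' (finProdFinEquiv (0, i)) = false) ∧ (∀ j, j ≠ 0 → ∀ i, y (finProdFinEquiv (j, i)) = y' (finProdFinEquiv (j, i))) then Literature.Computability.Cryptography.zeroState n (fun i => y (finProdFinEquiv (0, i))) else 0)).rank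

/-- item stmt-QuantumAdvantage-2118 · assembly · rank 1 · closed · moot by None · by planner
sources: Mathlib Nat.sInf_mem, Nat.pow_lt_pow_left
[assembly] StabDecompExists → FlatteningBound → RobustFlatteningWitness → (stmt-0247 verbatim).
ENGINE ROUTE: the conclusion is the shared kill item of route Dequantize, not the summit or its
negation (said in the thesis). Proof, provable now (bookkeeping): fix δ from the witness; given c
take k, n, L, r; A := {r' | ∃ φ, normSq(T^{⊗n} − φ) ≤ δ², χ(φ) = r'} is nonempty (φ = T^{⊗n}), so
χ_δ = sInf A ∈ A (Nat.sInf_mem) is attained at some φ* in the δ-ball; by StabDecompExists the set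
defining χ(φ*) is nonempty, so χ(φ*) = sInf is attained by a decomposition φ* = Σ_{i<s} c_i φ_i with
s = χ(φ*) = χ_δ; FlatteningBound gives rank L(φ*^{⊗k}) ≤ s^k · r (rewrite the block product of φ* as
that of the sum); the witness gives (n^c + c)^k · r < rank L(φ*^{⊗k}); hence (n^c+c)^k < s^k (r > 0
forced) and n^c + c < s = χ_δ(T^{⊗n}) (Nat.pow_lt_pow_left). Take t := n. -/
@[route_item "route-QuantumAdvantage-CodeFlattening"]
def Assembly : Prop :=
  StabDecompExists → FlatteningBound → RobustFlatteningWitness → ∃ δ : ℝ, 0 < δ ∧ δ < 1 ∧ ∀ c : ℕ, ∃ t : ℕ, t ^ c + c < Literature.Computability.QuantumComplexity.approxStabilizerRank δ (Literature.Computability.QuantumComplexity.tensorPow Literature.Computability.QuantumComplexity.magicT t)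

end Summit.QuantumAdvantage.QuantumAdvantage.Theses.CodeFlattening
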